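import Literature.Barriers.MatrixMultiplication.RectangularBarrierLem41Proofs
import Literature.Barriers.MatrixMultiplication.RectangularBarrierUpperSupportProofs
import Literature.Barriers.MatrixMultiplication.RectangularBarrierSoundness
import Literature.Barriers.MatrixMultiplication.RectangularBarrierProofs
import Literature.Barriers.MatrixMultiplication.RectangularBarrierAlphaCW
import Literature.Barriers.MatrixMultiplication.RectangularBarrierOmegaTwoCW
import HarnessLib

/-!
# `RectangularBarrier_holds` — the catalogue entry of Christandl–Le Gall–Lysikov–Zuiddam, discharged

Topic `Literature/Barriers/MatrixMultiplication`; DISCHARGE of the catalogue declaration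
`RectangularBarrier` of `RectangularBarrier.lean` (Christandl–Le Gall–Lysikov–Zuiddam, *Barriers for
rectangular matrix multiplication*, comput. complexity 34 (2025) = arXiv:2003.03019): the conjunction of
its six named facts, each now proved in a sibling file —

* `CLLZ2025_lem41_holds` (`RectangularBarrierLem41Proofs.lean`; Lemma 4.1, Strassen's support
  functional of `⟨a,b,c⟩`, via CVZ Thm. 2.19 for oblique tensors),
* `CLLZ2025_lem42_v_holds` (`RectangularBarrierUpperSupportProofs.lean`; Lemma 4.2 (v), `ζ^θ ≤ R̃`),
* `CLLZ2025_tMethodBound_sound_holds` (`RectangularBarrierSoundness.lean`; Thm. 2.1, Rem. 3.13),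
* `CLLZ2025_rem323_holds` (`RectangularBarrierProofs.lean`; Rem. 3.23, `ω + ωα/2 ≤ 3`),
* `CLLZ2025_alpha_barrier_CW_holds` (`RectangularBarrierAlphaCW.lean`; the `0.625` barrier on `α` via
  `CW_q`, `q ≥ 2`, from an exact dual certificate),
* `CLLZ2025_omegaTwo_barrier_CW_holds` (`RectangularBarrierOmegaTwoCW.lean`; Table 1, certified
  numerics).

With this the D-0021 catalogue entry is an unconditional theorem over every field. (The adequacy of
`ζ^θ` conditional only on Strassen's theorem is `isAdequate_upperSupportPoint_of_strassen` of
`RectangularBarrierLem41Proofs.lean`; it is not restated here.)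
-/

noncomputable section

namespace Literature.Barriers.MatrixMultiplication

/-- **The CLLZ barrier catalogue entry holds**: `RectangularBarrier` (Lemma 4.1, Lemma 4.2 (v),
Thm. 2.1/Rem. 3.13 soundness, Rem. 3.23, the `0.625` barrier on `α` via `CW_q`, and Table 1) is a
theorem. [cite: ChristandlLeGallLysikovZuiddam2025, Thm. 3.15 and Thm. 3.22] -/
theorem RectangularBarrier_holds : RectangularBarrier :=
  ⟨CLLZ2025_lem41_holds, CLLZ2025_lem42_v_holds, CLLZ2025_tMethodBound_sound_holds, CLLZ2025_rem323_holds,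
    CLLZ2025_alpha_barrier_CW_holds, CLLZ2025_omegaTwo_barrier_CW_holds⟩

end Literature.Barriers.MatrixMultiplication

end
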